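import Literature.NumberTheory.EllipticCurves.CMNewformGamma0EulerFactorsPadicCharacterProofs
import Literature.NumberTheory.EllipticCurves.CMNewformGamma0EulerFactorsPadicCharacterResidual
import HarnessLib

/-!
# `Ribet1977_cmNewform_gamma0_eulerFactor_padicCharacter` from its print residue — proofs

Topic `NumberTheory/EllipticCurves`; namespace `Literature.NumberTheory.EllipticCurves.ModularForms`. THEOREMS ONLY. The named fact
`Ribet1977_cmNewform_gamma0_eulerFactor_padicCharacter` (Euler factors of the `Γ₀` CM newform through the `p`-adic character at EVERY prime `ℓ ≠ p`) follows from
its print residue `Ribet1977_cmNewform_gamma0_level_and_badEulerFactor_padicCharacter` (LEVEL: `M ∣ |d_K|·N𝔪`; BAD: the identity at the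
primes of `|d_K|·N𝔪`) and the THEOREM `eulerFactor_padicCharacter_of_not_dvd` (the identity at `ℓ ∤ p·|d_K|·N𝔪`, `ℓ ∤ M`, file `…Proofs.lean`).

References: [Ribet1977Nebentypus] §3 Cor. (3.5), Remark (3.5); [Miyake2006] Thm. 4.6.19, 4.8.2.
-/

noncomputable section

open scoped NumberField ModularForm MatrixGroups
open NumberField IsDedekindDomain CongruenceSubgroup Polynomial Rat.HeightOneSpectrum
open Literature.NumberTheory.GaloisRepresentations Literature.NumberTheory.LFunctions
  Literature.NumberTheory.Automorphic Literature.NumberTheory.EllipticCurves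

namespace Literature.NumberTheory.EllipticCurves.ModularForms

section OfResidual

/-- ★ **`Ribet1977_cmNewform_gamma0_eulerFactor_padicCharacter` FROM ITS PRINT RESIDUE.** If the level of `g` divides `|d_K|·N𝔪` and the Euler identity
holds at the primes of `|d_K|·N𝔪` (the named fact `Ribet1977_cmNewform_gamma0_level_and_badEulerFactor_padicCharacter`), then it holds at EVERY prime `ℓ ≠ p`:
at `ℓ ∤ |d_K|·N𝔪` the level clause `M ∣ |d_K|·N𝔪` gives `ℓ ∤ M` and `eulerFactor_padicCharacter_of_not_dvd` applies. [cite: Ribet1977Nebentypus, §3, Cor. (3.5) and Remark (3.5)]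
[cite: Miyake2006, Thm. 4.6.19, Thm. 4.8.2] -/
theorem ribet1977_cmNewform_gamma0_eulerFactor_padicCharacter_of_residual
    (hres : Ribet1977_cmNewform_gamma0_level_and_badEulerFactor_padicCharacter) :
    Ribet1977_cmNewform_gamma0_eulerFactor_padicCharacter := by
  intro K _ _ hK2 htc σ 𝔪 h𝔪 ψ hψ hψpow p _ e M _ g ι hng hcoeffψ S θ hθ ℓ hℓ hℓp Tℓ φ f hT hφ hf
  obtain ⟨hlevel, hbad⟩ := hres K hK2 htc σ 𝔪 h𝔪 ψ hψ hψpow p e M g ι hng hcoeffψ S θ hθ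
  by_cases hℓD : ℓ ∣ (discr K).natAbs * Ideal.absNorm 𝔪
  · exact hbad ℓ hℓ hℓp hℓD Tℓ φ f hT hφ hf
  · exact eulerFactor_padicCharacter_of_not_dvd hK2 htc σ hψ hψpow e g ι hcoeffψ θ hθ hℓ hℓp hℓD (fun hM ↦ hℓD (hM.trans hlevel)) Tℓ φ f hT hφ hf

end OfResidual

end Literature.NumberTheory.EllipticCurves.ModularForms

end
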